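import Summits.ValiantsHypothesis.ValiantsHypothesis.Theorems.FifoMatchingNNDivisionHardShadowConstReadTwinFibre

/-!
(PART 7 of 7 of the port — part 7 — §5g the generic form (`momPin`, `blockPoly`, ★ `exists_separating_pin`, ★★★★★ `distinctS_decided`: pairwise distinct `S`-blocks ⇒ decided); split for the 400-line cap; texts verbatim by name, docstrings added to helpers.)
# SHADOW-CONSTANT READ / TWIN ROWS — decided classes of the located law of record C′ = `ExactPencilLaw`

Theorems-side port (staged by the author val-idea-41 g3; press as `Theorems/FifoMatchingNNDivisionHardShadowConstReadGeneric.lean`,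
`--kind proof --supports stmt-ValiantsHypothesis-21181 --as helper`) of the crux workfile `Cruxes/NNDivisionHard/ShadowConstRead41.lean`
REV 10 @72ea85f2ab68 (sha16 a021d0dfd0d83740, 1482 l., farm rc 0 / 0 sorries / 0 warnings; critic of record val-idea-crit-9 g2: WAVE-6
KEEP/KILL LIST 2026-08-29T00:50:44Z «41 g3 … `ShadowConstRead41` r1→r6 (★★★ `exactTilted_law_on_offDiagConst`, ★★★
`exactTilted_body_of_partialCommonMax`, `offDiagConst_decided`, ★★★★ `twinBlind_decided` / `interSpan_decided` / `blocks_decided` /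
`twinPCM_decided`)» KEPT; revs 7–10 (§5c–§5f) filed after the list's 00:30Z cut, graded in the wave-7 ledger).  Namespace
`Summit.ValiantsHypothesis.ValiantsHypothesis.Theorems.FifoMatching.ShadowConstRead` (parallel to `…LocatedRows`, whose frame — `T`, `RowFamily`, `three_pow_le_of_block`,
`hCOR`, `exactTilted`, `ExactPencilLaw`, `concl_of_lawBody`, `T_lt_of_block'`, `two_pow_half_mul_le` — is used BY NAME).

CONTENT: typed DECIDED CLASSES of the located law C′ (`exactTilted.Law`) in the tree's flat socket
`HasEFOfSize (corPolytope n + convexHull ℝ (Set.range q)) r → T c n < r`: shadow-constant / diagonal passengers (anchored star–clique tilt),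
partial-common-maximiser lists (junk-tolerant Kaibel–Weltge count), twin-blind / twin-PCM lists (antipodal twin rows; every span of 38 g2's
interaction matrices, so `Q_II`), and the twin transfer: a unique top — or a PCM on the top fibre — of ONE entrywise-nonnegative `S × S` pin.

HONEST LABEL: support theorems about the located LAW C′ on CLASSES of passengers, for an OPEN crux; `ExactPencilLaw` (C′), COR-VIRTUAL,
21181 `NNDivisionHard` are OPEN.  VP ≠ VNP is NOT proved here or anywhere in this tree.
-/

set_option autoImplicit false

-- the mandated summit-side namespace repeats a component by design (single-problem summit)
set_option linter.dupNamespace false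

noncomputable section

namespace Summit.ValiantsHypothesis.ValiantsHypothesis.Theorems.FifoMatching.ShadowConstRead

open Matrix Finset
open Literature.Barriers.PneNP (HasEFOfSize three_pow_le_card_mul_two_pow_of_cover_univ)
open Literature.Combinatorics.Optimization.FixedSizePsdRank (Cube bvec flat vecOuter corPolytope flat_dotProduct_vecOuter
  flat_dotProduct_le_of_mem_corPolytope)
open Summit.ValiantsHypothesis.ValiantsHypothesis.Theorems.FifoMatching.XcDivision
  (udInd udPt udRow udMat udInd_apply udInd_sq udInd_inter ud_data udRow_dotProduct_flat_diagonal flat_dotProduct_flat)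
open Summit.ValiantsHypothesis.ValiantsHypothesis.Theorems.FifoMatching.GridCorShadow (four_T_lt_two_pow)
open Summit.ValiantsHypothesis.ValiantsHypothesis.Theorems.FifoMatching.LocatedRows
  (T RowFamily three_pow_le_of_block two_pow_half_mul_le T_lt_of_block' hCOR le_hCOR exists_eq_hCOR flat_le_hCOR exactTilted ExactPencilLaw
    concl_of_lawBody CorVirtualHardN corVirtualHardN_of_exactPencilLaw sum_mul_udInd flat_dotProduct_udPt_eq)
open scoped Pointwise

section Part7
variable {k n : ℕ}

/-! §1 THE FRAME is the tree's, BY NAME: `T`, `RowFamily`, `three_pow_le_of_block`, `hCOR`, `le_hCOR`, `exists_eq_hCOR`, `flat_le_hCOR`,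
`exactTilted`, `ExactPencilLaw`, `concl_of_lawBody` (`…RowFamilies` / `…LocatedRowsColumnCoupled`), `two_pow_half_mul_le` (`…PairPencil`),
`T_lt_of_block'` (`…PinExposed`), `sum_mul_udInd` / `flat_dotProduct_udPt_eq` (`…LocatedRowsCeiling`). -/
/-! ### §5g (E21, generic form) — DISTINCT `S`-BLOCKS ARE DECIDED

The genericity step of (E21) in kernel: if the listed passenger points have pairwise distinct `S × S` blocks
(`S = ι₂ (Fin k)`), then the MOMENT PIN `t ^ e(x,y)` on `S × S` (for a suitable real `t > 0` avoiding the finitely many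
roots of the pairwise block polynomials) has a UNIQUE top, so `sTop_decided` applies: the class
«some near-half `S` separates the vertices» is DECIDED by C′ — no functional has to be exhibited. -/



/-- the exponent code of a matrix position. -/
noncomputable def ecode (n : ℕ) (x y : Fin n) : ℕ := (Fintype.equivFin (Fin n × Fin n) (x, y) : ℕ)

/-- `ecode` is injective on positions. -/
theorem ecode_injective {x y x' y' : Fin n} (h : ecode n x y = ecode n x' y') : x = x' ∧ y = y' := by
  unfold ecode at h
  have h1 := (Fintype.equivFin (Fin n × Fin n)).injective (Fin.ext h)
  simpa [Prod.mk.injEq] using h1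

/-- the MOMENT PIN on `S × S`: weight `t ^ ecode (x, y)`, zero off `S × S`. -/
noncomputable def momPin (S : Finset (Fin n)) (t : ℝ) : Matrix (Fin n) (Fin n) ℝ :=
  fun x y => if x ∈ S ∧ y ∈ S then t ^ ecode n x y else 0

/-- the moment pin is entrywise nonnegative for `t ≥ 0`. -/
theorem momPin_nonneg (S : Finset (Fin n)) {t : ℝ} (ht : 0 ≤ t) (x y : Fin n) : 0 ≤ momPin S t x y := by
  unfold momPin; split_ifs
  · exact pow_nonneg ht _
  · exact le_rfl

/-- the moment pin is supported on `S × S`. -/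
theorem momPin_support (S : Finset (Fin n)) (t : ℝ) (x y : Fin n) (h : momPin S t x y ≠ 0) : x ∈ S ∧ y ∈ S := by
  unfold momPin at h; by_contra hc; exact h (if_neg hc)

/-- the BLOCK POLYNOMIAL of `Q` on `S`: `∑_{x,y ∈ S} Q x y · X ^ ecode (x, y)`. -/
noncomputable def blockPoly (S : Finset (Fin n)) (Q : Matrix (Fin n) (Fin n) ℝ) : Polynomial ℝ :=
  ∑ x ∈ S, ∑ y ∈ S, Polynomial.C (Q x y) * Polynomial.X ^ ecode n x y

/-- pairing with the moment pin evaluates the block polynomial. -/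
theorem flat_momPin_dot (S : Finset (Fin n)) (t : ℝ) (Q : Matrix (Fin n) (Fin n) ℝ) :
    flat (momPin S t) ⬝ᵥ flat Q = (blockPoly S Q).eval t := by
  classical
  rw [flat_dotProduct_flat]
  unfold momPin blockPoly
  simp only [Polynomial.eval_finsetSum, Polynomial.eval_mul, Polynomial.eval_C, Polynomial.eval_pow,
    Polynomial.eval_X]
  have key : ∀ i j : Fin n, (if i ∈ S ∧ j ∈ S then t ^ ecode n i j else 0) * Q i j
      = if i ∈ S then (if j ∈ S then Q i j * t ^ ecode n i j else 0) else 0 := by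
    intro i j
    by_cases hi : i ∈ S <;> by_cases hj : j ∈ S <;> simp [hi, hj, mul_comm]
  rw [Finset.sum_congr rfl fun i _ => Finset.sum_congr rfl fun j _ => key i j]
  have inner : ∀ i : Fin n, (∑ j, if j ∈ S then Q i j * t ^ ecode n i j else 0)
      = ∑ j ∈ S, Q i j * t ^ ecode n i j := by
    intro i
    rw [Finset.sum_ite_mem, Finset.univ_inter]
  have outer : (∑ i, if i ∈ S then (∑ j, if j ∈ S then Q i j * t ^ ecode n i j else 0) else 0)
      = ∑ i ∈ S, (∑ j, if j ∈ S then Q i j * t ^ ecode n i j else 0) := by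
    rw [Finset.sum_ite_mem, Finset.univ_inter]
  have step : (∑ i, ∑ j, if i ∈ S then (if j ∈ S then Q i j * t ^ ecode n i j else 0) else 0)
      = ∑ i, if i ∈ S then (∑ j, if j ∈ S then Q i j * t ^ ecode n i j else 0) else 0 := by
    refine Finset.sum_congr rfl fun i _ => ?_
    by_cases hi : i ∈ S
    · simp [hi]
    · simp [hi]
  rw [step, outer]
  exact Finset.sum_congr rfl fun i _ => inner i

/-- the block polynomial is additive. -/
theorem blockPoly_sub (S : Finset (Fin n)) (Q Q' : Matrix (Fin n) (Fin n) ℝ) :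
    blockPoly S (Q - Q') = blockPoly S Q - blockPoly S Q' := by
  unfold blockPoly
  simp only [Matrix.sub_apply, Polynomial.C_sub, sub_mul, Finset.sum_sub_distrib]

/-- the coefficient of the block polynomial at `ecode (x₀, y₀)` is the entry. -/
theorem blockPoly_coeff (S : Finset (Fin n)) (Q : Matrix (Fin n) (Fin n) ℝ) {x₀ y₀ : Fin n}
    (hx : x₀ ∈ S) (hy : y₀ ∈ S) : (blockPoly S Q).coeff (ecode n x₀ y₀) = Q x₀ y₀ := by
  classical
  unfold blockPoly
  simp only [Polynomial.finsetSum_coeff, Polynomial.coeff_C_mul_X_pow]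
  rw [Finset.sum_eq_single x₀]
  · rw [Finset.sum_eq_single y₀]
    · simp
    · intro y _ hyy
      rw [if_neg]
      intro h; exact hyy (ecode_injective h).2.symm
    · intro h; exact absurd hy h
  · intro x _ hxx
    refine Finset.sum_eq_zero fun y _ => ?_
    rw [if_neg]
    intro h; exact hxx (ecode_injective h).1.symm
  · intro h; exact absurd hx h

/-- a nonzero `S × S` entry makes the block polynomial nonzero. -/
theorem blockPoly_ne_zero (S : Finset (Fin n)) (D : Matrix (Fin n) (Fin n) ℝ) {x₀ y₀ : Fin n}
    (hx : x₀ ∈ S) (hy : y₀ ∈ S) (hD : D x₀ y₀ ≠ 0) : blockPoly S D ≠ 0 := by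
  intro h
  have := blockPoly_coeff S D hx hy
  rw [h, Polynomial.coeff_zero] at this
  exact hD this.symm

/-- ★ GENERICITY: pairwise distinct `S × S` blocks ⇒ a nonneg pin supported on `S × S` separating ALL listed points
(hence with a unique top). The pin is the moment pin at `t = 1 + ∑ |roots|`. -/
theorem exists_separating_pin (S : Finset (Fin n)) {K : ℕ} (Qm : Fin (K + 1) → Matrix (Fin n) (Fin n) ℝ)
    (hdis : ∀ j j', j ≠ j' → ∃ x ∈ S, ∃ y ∈ S, Qm j x y ≠ Qm j' x y) :
    ∃ P : Matrix (Fin n) (Fin n) ℝ, (∀ x y, 0 ≤ P x y) ∧ (∀ x y, P x y ≠ 0 → x ∈ S ∧ y ∈ S) ∧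
      Function.Injective (fun j => flat P ⬝ᵥ flat (Qm j)) := by
  classical
  -- the finite set of bad parameters
  let B : Finset ℝ := (Finset.univ : Finset (Fin (K + 1) × Fin (K + 1))).biUnion
    (fun jj => (blockPoly S (Qm jj.1 - Qm jj.2)).roots.toFinset)
  let t : ℝ := 1 + ∑ b ∈ B, |b|
  have hBsum : 0 ≤ ∑ b ∈ B, |b| := Finset.sum_nonneg fun b _ => abs_nonneg b
  have ht0 : 0 < t := by positivity
  have htB : t ∉ B := by
    intro htB
    have h1 : |t| ≤ ∑ b ∈ B, |b| := Finset.single_le_sum (fun b _ => abs_nonneg b) htB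
    rw [abs_of_pos ht0] at h1
    linarith
  refine ⟨momPin S t, momPin_nonneg S ht0.le, momPin_support S t, ?_⟩
  intro j j' hjj
  by_contra hne
  obtain ⟨x, hx, y, hy, hD⟩ := hdis j j' hne
  have hp0 : blockPoly S (Qm j - Qm j') ≠ 0 :=
    blockPoly_ne_zero S (Qm j - Qm j') hx hy (by simpa [Matrix.sub_apply, sub_eq_zero] using hD)
  have hroot : (blockPoly S (Qm j - Qm j')).IsRoot t := by
    rw [Polynomial.IsRoot.def, blockPoly_sub, Polynomial.eval_sub, ← flat_momPin_dot, ← flat_momPin_dot]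
    have : flat (momPin S t) ⬝ᵥ flat (Qm j) = flat (momPin S t) ⬝ᵥ flat (Qm j') := by simpa using hjj
    rw [this, sub_self]
  apply htB
  rw [Finset.mem_biUnion]
  exact ⟨(j, j'), Finset.mem_univ _, by rw [Multiset.mem_toFinset]; exact (Polynomial.mem_roots hp0).2 hroot⟩

/-- ★★★★★ (E21, GENERIC FORM) DISTINCT `S`-BLOCKS ARE DECIDED: if for the twin half `S = ι₂ (Fin k)` the listed passenger
points have pairwise distinct `S × S` blocks, the passenger is decided by C′ (block `k − 2`, so for `n ≤ 2k + 1` the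
budget is beaten for `n ≥ n₀`). In particular a passenger is an ENEMY of C′ only if, for EVERY near-half `S`, two of its
listed points agree on `S × S`. -/
theorem distinctS_decided (c₀ : ℕ) : ∃ n₀ : ℕ, ∀ n ≥ n₀, ∀ (k : ℕ) (ι₁ ι₂ : Fin k ↪ Fin n), (∀ i j, ι₁ i ≠ ι₂ j) →
    n ≤ 2 * k + 1 → ∀ (K : ℕ) (Qm : Fin (K + 1) → Matrix (Fin n) (Fin n) ℝ) (r : ℕ),
    (∀ j j', j ≠ j' → ∃ x ∈ (Finset.univ : Finset (Fin k)).map ι₂, ∃ y ∈ (Finset.univ : Finset (Fin k)).map ι₂,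
      Qm j x y ≠ Qm j' x y) →
    HasEFOfSize (corPolytope n + convexHull ℝ (Set.range fun j => flat (Qm j))) r → T c₀ n < r := by
  classical
  obtain ⟨n₀, hn₀⟩ := sTop_decided c₀
  refine ⟨n₀, fun n hn k ι₁ ι₂ hι hnk K Qm r hdis hR => ?_⟩
  obtain ⟨P, hP0, hPS, hinj⟩ := exists_separating_pin ((Finset.univ : Finset (Fin k)).map ι₂) Qm hdis
  obtain ⟨js, -, hjs⟩ := Finset.exists_max_image (Finset.univ : Finset (Fin (K + 1)))
    (fun j => flat P ⬝ᵥ flat (Qm j)) ⟨0, Finset.mem_univ _⟩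
  refine hn₀ n hn k ι₁ ι₂ hι hnk K (fun j => flat (Qm j)) r P hP0 hPS js (fun j hj => ?_) hR
  exact lt_of_le_of_ne (hjs j (Finset.mem_univ _)) (fun h => hj (hinj h))

end Part7

end Summit.ValiantsHypothesis.ValiantsHypothesis.Theorems.FifoMatching.ShadowConstRead
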